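import Mathlib
import Summits.Ventures.PercRepro2.V2SP
import Summits.Ventures.PercRepro2.Tail2DCount
import Summits.Ventures.PercRepro2.Tail2DThreePoint
import Summits.Ventures.PercRepro2.Tail2DThreePointComm
import Summits.Ventures.PercRepro2.Tail2DFlow3M2
import Summits.Ventures.PercRepro2.Tail2DFlow3M1
import Summits.Ventures.PercRepro2.Tail2DFlow3

/-!
# The flow-three step on a concrete cube: `P(e³) ∧ P(e³)` in parallel (seat mine-b, cell pub-perc-repro2)

`tb = P(e³) ∧ P(e³)` (two bundles of three free edges in series) has max-flow `3` and flow counts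
`2, 6, 6, 6, 18, 6, 1, 9, 9, 1` at `(0, 0), (1, 0), (0, 1), (2, 0), (1, 1), (0, 2), (3, 0), (2, 1), (1, 2), (0, 3)` (by `decide` on the 64 configurations).  The three fractional transports of
`hconv3_isMTail` are given explicitly (`l2`, `l4`, `l1`, computed by mining/mine-b/code/g29/e70_example3.py
and checked here by `simp`/`norm_num`), so every pattern of the M♮ class stays in the class under parallel
composition with `tb` (`MTailPat.par_tb`); e.g. the 12-edge network `tb ∗ tb` (max-flow 6) has an
M♮-concave counting tail (`mtail_tb_par_tb`).
-/

namespace Summit.Ventures.PercRepro2.Tail2D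

open V2Closure

/-- the network `P(e³) ∧ P(e³)`: two bundles of three free edges in series -/
def tb : V2Closure.SP := .ser (.par (.par .free .free) .free) (.par (.par .free .free) .free)

/-- `tb` has max-flow `≤ 3` -/
theorem tb_flowLeThree : FlowLeThree tb := by
  unfold FlowLeThree tb
  rintro ⟨⟨⟨a1, a2⟩, a3⟩, b⟩
  cases a1 <;> cases a2 <;> cases a3 <;> simp [SP.rLab, SP.bLab, V2Closure.serR, V2Closure.serB, V2Closure.parR, V2Closure.parB] <;> omega

/-- the ten flow counts of `tb` -/
theorem tb_counts : flowCount tb 0 0 = 2 ∧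
    flowCount tb 1 0 = 6 ∧
    flowCount tb 0 1 = 6 ∧
    flowCount tb 2 0 = 6 ∧
    flowCount tb 1 1 = 18 ∧
    flowCount tb 0 2 = 6 ∧
    flowCount tb 3 0 = 1 ∧
    flowCount tb 2 1 = 9 ∧
    flowCount tb 1 2 = 9 ∧
    flowCount tb 0 3 = 1 := by
  unfold flowCount tb; decide

/-- parallel composition with `tb` keeps the M♮ class (either side): the three transports are explicit -/
theorem MTailPat.par_tb {s : V2Closure.SP} {L : ℤ} (hs : MTailPat s L) :
    MTailPat (.par s tb) (L + 3) ∧ MTailPat (.par tb s) (L + 3) := by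
  obtain ⟨c00, c10, c01, c20, c11, c02, c30, c21, c12, c03⟩ := tb_counts
  refine MTailPat.par_flow3 tb tb_flowLeThree ?_
  simp only [c00, c10, c01, c20, c11, c02, c30, c21, c12, c03]
  push_cast
  exact hconv3_isMTail hs (n00 := 2) (n10 := 6) (n01 := 6) (n20 := 6) (n11 := 18) (n02 := 6) (n30 := 1) (n21 := 9) (n12 := 9) (n03 := 1)
    (by norm_num)
    (by norm_num)
    (by norm_num)
    (by norm_num)
    (by norm_num)
    (by norm_num)
    (by norm_num)
    (by norm_num)
    (by norm_num)
    (by norm_num)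
    (l2 := ![(12:ℝ), 0, 18, 2, 36, 54, 6, 36, 54, 6, 6, 9, 1, 6, 0, 18, 9])
    (by intro e; fin_cases e <;> norm_num)
    (by simp; norm_num)
    (by simp)
    (by simp; norm_num)
    (by simp)
    (by simp; norm_num)
    (by simp)
    (by simp; norm_num)
    (by simp; norm_num)
    (by simp)
    (by simp)
    (by simp)
    (by simp; norm_num)
    (by simp)
    (by simp)
    (by simp)
    (by simp; norm_num)
    (by simp; norm_num)
    (by simp; norm_num)
    (by simp)
    (by simp)
    (by simp)
    (by simp)
    (by simp; norm_num)
    (by simp)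
    (by simp; norm_num)
    (by simp; norm_num)
    (by simp; norm_num)
    (by simp)
    (by simp; norm_num)
    (by simp)
    (l4 := ![(12:ℝ), 0, 18, 2, 36, 54, 6, 36, 54, 6, 6, 9, 1, 6, 0, 18, 9])
    (by intro e; fin_cases e <;> norm_num)
    (by simp; norm_num)
    (by simp)
    (by simp; norm_num)
    (by simp)
    (by simp; norm_num)
    (by simp)
    (by simp; norm_num)
    (by simp; norm_num)
    (by simp)
    (by simp)
    (by simp)
    (by simp; norm_num)
    (by simp)
    (by simp)
    (by simp)
    (by simp; norm_num)
    (by simp; norm_num)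
    (by simp; norm_num)
    (by simp)
    (by simp)
    (by simp)
    (by simp)
    (by simp; norm_num)
    (by simp)
    (by simp; norm_num)
    (by simp; norm_num)
    (by simp; norm_num)
    (by simp)
    (by simp; norm_num)
    (by simp)
    (l1 := ![(0:ℝ), 12, 2, 36, 0, 18, 0, 12, 18, 2, 0, 6, 54, 0, 54, 0, 6, 6, 54, 0, 54, 0, 0, 6])
    (by intro e; fin_cases e <;> norm_num)
    (by simp; norm_num)
    (by simp; norm_num)
    (by simp; norm_num)
    (by simp)
    (by simp; norm_num)
    (by simp; norm_num)
    (by simp)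
    (by simp)
    (by simp; norm_num)
    (by simp; norm_num)
    (by simp)
    (by simp)
    (by simp; norm_num)
    (by simp; norm_num)
    (by simp)
    (by simp)
    (by simp; norm_num)
    (by simp; norm_num)
    (by simp; norm_num)
    (by simp; norm_num)
    (by simp)
    (by simp; norm_num)
    (by simp; norm_num)
    (by simp; norm_num)
    (by simp)
    (by simp; norm_num)
    (by simp)
    (by simp)
    (by simp; norm_num)
    (by simp; norm_num)
    (by simp)
    (by simp)
    (by simp)
    (by simp)
    (by simp)
    (by simp)
    (by simp)

/-- `tb` itself is in the class (`Good`: series of two bundle-parallel terms) -/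
theorem mtail_tb : MTailPat tb 3 := by
  have e1 : Good (.par .free .free) (1 + 1) :=
    Good.par .free Good.free flowLeOne_free ⟨false, by decide⟩ ⟨true, by decide⟩
  have e2 : Good (.par (.par .free .free) .free) (1 + 1 + 1) :=
    Good.par .free e1 flowLeOne_free ⟨false, by decide⟩ ⟨true, by decide⟩
  have h : Good tb (min (1 + 1 + 1) (1 + 1 + 1)) := Good.ser e2 e2
  simpa using MTailPat.of_good h

/-- **the cube of `(P(e³) ∧ P(e³)) ∗ (P(e³) ∧ P(e³))`** (12 free edges, max-flow 6) has an M♮-concave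
counting tail of level 6 -/
theorem mtail_tb_par_tb : IsMTail (cnt (.par tb tb)) 6 := by
  have := (MTailPat.par_tb mtail_tb).1
  simpa [MTailPat] using this

end Summit.Ventures.PercRepro2.Tail2D
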